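import Literature.NumberTheory.EllipticCurves.DeuringSplitOrdinarySqrtTwoProofs
import Mathlib.GroupTheory.OrderOfElement
import Mathlib.NumberTheory.LegendreSymbol.QuadraticReciprocity
import HarnessLib

/-!
# The `8`-torsion Frobenius argument on `B₁ : y² = x³ + 4x² + 2x` (tools for Brewer's sign law at `p ≡ 3 (mod 8)`)

Topic `Literature/NumberTheory/EllipticCurves`, namespace
`Literature.NumberTheory.EllipticCurves.SqrtTwoTwist.EightTorsion` (sequel to `SqrtTwoTwistBrewerOneModEight`,
tools for `SqrtTwoTwistBrewerTheorem`).  THEOREMS ONLY.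

For a prime `p ≡ 3 (mod 8)` the sign in `a_p(B₁) = ±2c` (`p = c² + 2d²`) is invisible on `B₁(𝔽_p)` and on every
point count over `𝔽_{p^k}`; it IS visible in the action of the `p`-Frobenius `σ` on the `8`-torsion of `B₁` over
`\bar 𝔽_p`, through the `𝔽_p`-rational endomorphism `ψ = [√-2]` (`DeuringSqrtTwo.sqrtNegTwo`, `ψ² = [-2]`) and
the pointwise relation `σ² - a_p σ + p = 0` (the tree's elementary `frobenius_sq_sub_trace_smul_add_card_smul`).
This file isolates the two ingredients that do not mention the Frobenius relation:

* §1 explicit group-law computations on a Weierstrass equation with `(a₁, a₂, a₃, a₄, a₆) = (0, 4, 0, 2, 0)` over any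
  field with `2 ≠ 0`: with `w² = 2`, `t² = 2 + w`, the points `T₀ = (0,0)`, `T± = (-2 ± w, 0)`, `R = (w, 2t)` satisfy
  `2R = T₀`, `R + T₋ = (-w, 2t(1 - w))`, `T₊ + T₋ = T₀`, and the `2`-torsion is `{O, T₀, T₊, T₋}`
  (`R_add_R`, `R_add_Tm`, `Tp_add_Tm`, `two_torsion_cases`);
* §2 the abstract `8`-torsion lemma `trace_mod_eight`: in any abelian group with commuting endomorphisms `σ, ψ`,
  `ψ² = -2`, a chain `2S = R`, `2R = T₀ ≠ 0`, `2T₀ = 0`, the above incidences, `σ R = ε R + T₋` (`ε = ±1`) and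
  `σ²S - aσS + qS = 0` with `q ≡ 3 (mod 8)` force `a ≡ 2ε (mod 8)`;
* §3 the arithmetic of `\bar 𝔽_p`, `p ≡ 3 (mod 8)`: `w^p = -w` and the octic evaluation
  `(2 + w)^{(p-1)/2} = w - 1` (`p ≡ 3 (mod 16)`) resp. `1 - w` (`p ≡ 11 (mod 16)`) via a primitive `8`-th root of
  unity `η = (w + δ)/2`, `δ² = -2`, `2 + w = η⁻¹(η + 1)²` (`two_add_w_pow`); and the values of the Frobenius and of
  `ψ` on the explicit points of `B₁(\bar 𝔽_p)` (`map_some_of_pow`, `sqrtNegTwo_R`, `sqrtNegTwo_T`).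

References: Silverman, *AEC* III.2.3 (group law); Rajwade, *Arithmetic on curves with complex multiplication by
`√-2`*, Proc. Camb. Phil. Soc. 64 (1968), Thm. 1 (the sign law reproved by these tools); Leonard–Williams 1975.
-/

noncomputable section

open scoped Classical

namespace Literature.NumberTheory.EllipticCurves

namespace SqrtTwoTwist

namespace EightTorsion

open _root_.WeierstrassCurve

/-! ### §1 Group-law computations on `(0, 4, 0, 2, 0)` -/

section GroupLaw

variable {F : Type*} [Field F] {V : WeierstrassCurve F}

/-- Two affine points with equal coordinates are equal (proof irrelevance for the nonsingularity witness).
[cite: SilvermanAEC2009, III.2.3] -/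
theorem pt_eq {x y x' y' : F} {h : V.toAffine.Nonsingular x y} {h' : V.toAffine.Nonsingular x' y'}
    (hx : x = x') (hy : y = y') : (Affine.Point.some x y h : V.toAffine.Point) = .some x' y' h' := by
  subst hx hy; rfl

variable (h₁ : V.a₁ = 0) (h₂ : V.a₂ = 4) (h₃ : V.a₃ = 0) (h₄ : V.a₄ = 2) (h₆ : V.a₆ = 0)
include h₁ h₂ h₃ h₄ h₆

/-- The equation of `V = (0, 4, 0, 2, 0)`: `y² = x³ + 4x² + 2x`. [cite: SilvermanAEC2009, III.1] -/
theorem equation_iff' (x y : F) : V.toAffine.Equation x y ↔ y ^ 2 = x ^ 3 + 4 * x ^ 2 + 2 * x := by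
  rw [Affine.equation_iff, h₁, h₂, h₃, h₄, h₆]
  constructor <;> intro h <;> linear_combination h

/-- `Δ(V) = 512`. [cite: SilvermanAEC2009, III.1] -/
theorem Δ_eq : V.Δ = 512 := by
  simp only [WeierstrassCurve.Δ, WeierstrassCurve.b₂, WeierstrassCurve.b₄, WeierstrassCurve.b₆,
    WeierstrassCurve.b₈, h₁, h₂, h₃, h₄, h₆]
  norm_num

/-- Over a field with `2 ≠ 0`, every solution of `y² = x³ + 4x² + 2x` is a nonsingular point (`Δ = 2⁹ ≠ 0`).
[cite: SilvermanAEC2009, III.1 Prop. 1.4] -/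
theorem nonsingular_of_eq (h2 : (2 : F) ≠ 0) {x y : F} (h : y ^ 2 = x ^ 3 + 4 * x ^ 2 + 2 * x) :
    V.toAffine.Nonsingular x y := by
  have hΔ : V.Δ ≠ 0 := by
    rw [Δ_eq h₁ h₂ h₃ h₄ h₆, show (512 : F) = 2 ^ 9 by norm_num]; exact pow_ne_zero _ h2
  exact (Affine.equation_iff_nonsingular_of_Δ_ne_zero hΔ).mp ((equation_iff' h₁ h₂ h₃ h₄ h₆ x y).mpr h)

/-- The equation from nonsingularity. [cite: SilvermanAEC2009, III.1] -/
theorem eq_of_nonsingular {x y : F} (h : V.toAffine.Nonsingular x y) : y ^ 2 = x ^ 3 + 4 * x ^ 2 + 2 * x :=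
  (equation_iff' h₁ h₂ h₃ h₄ h₆ x y).mp h.1

omit h₂ h₄ h₆ in
/-- `-(x, y) = (x, -y)` on `V` (as the `negY` polynomial). [cite: SilvermanAEC2009, III.2.3] -/
theorem negY_eq (x y : F) : V.toAffine.negY x y = -y := by
  rw [Affine.negY, h₁, h₃]; ring

omit h₃ h₄ h₆ in
/-- The `x`-coordinate of a sum: `λ² - 4 - x₁ - x₂`. [cite: SilvermanAEC2009, III.2.3] -/
theorem addX_eq (x₁ x₂ ℓ : F) : V.toAffine.addX x₁ x₂ ℓ = ℓ ^ 2 - 4 - x₁ - x₂ := by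
  rw [Affine.addX, h₁, h₂]; ring

omit h₄ h₆ in
/-- The `y`-coordinate of a sum. [cite: SilvermanAEC2009, III.2.3] -/
theorem addY_eq (x₁ x₂ y₁ ℓ : F) : V.toAffine.addY x₁ x₂ y₁ ℓ = -(ℓ * (ℓ ^ 2 - 4 - x₁ - x₂ - x₁) + y₁) := by
  rw [Affine.addY, Affine.negY, Affine.negAddY, addX_eq h₁ h₂, h₁, h₃]; ring

omit h₂ h₄ h₆ in
/-- `-(x, y) = (x, -y)` as points. [cite: SilvermanAEC2009, III.2.3] -/
theorem neg_pt {x y : F} (h : V.toAffine.Nonsingular x y) (h' : V.toAffine.Nonsingular x (-y)) :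
    -(Affine.Point.some x y h : V.toAffine.Point) = .some x (-y) h' := by
  rw [Affine.Point.neg_some]; exact pt_eq rfl (negY_eq h₁ h₃ x y)

omit h₂ h₄ h₆ in
/-- `(x, 0) + (x, 0) = O`. [cite: SilvermanAEC2009, III.2.3] -/
theorem T_add_T {x : F} (h : V.toAffine.Nonsingular x 0) :
    (Affine.Point.some x 0 h : V.toAffine.Point) + .some x 0 h = 0 :=
  Affine.Point.add_self_of_Y_eq (by rw [negY_eq h₁ h₃, neg_zero])

/-- The points of order dividing `2`: `P + P = O` forces `P = O` or `P = (x, 0)` with `x(x² + 4x + 2) = 0`.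
[cite: SilvermanAEC2009, III.2.3] -/
theorem eq_of_add_self_eq_zero (h2 : (2 : F) ≠ 0) {P : V.toAffine.Point}
    (hP : P + P = 0) : P = 0 ∨ ∃ (x : F) (h : V.toAffine.Nonsingular x 0),
      P = .some x 0 h ∧ x * (x ^ 2 + 4 * x + 2) = 0 := by
  rcases P with _ | ⟨x, y, hxy⟩
  · exact Or.inl rfl
  · right
    by_cases hy : y = V.toAffine.negY x y
    · have hy0 : y = 0 := by
        rw [negY_eq h₁ h₃] at hy
        have : (2 : F) * y = 0 := by linear_combination hy
        exact (mul_eq_zero.mp this).resolve_left h2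
      subst hy0
      refine ⟨x, hxy, rfl, ?_⟩
      have := eq_of_nonsingular h₁ h₂ h₃ h₄ h₆ hxy
      linear_combination -this
    · exfalso
      rw [Affine.Point.add_self_of_Y_ne hy] at hP
      exact Affine.Point.some_ne_zero _ hP

variable {w t : F}

/-- With `w² = 2` the `2`-torsion of `V` is `{O, (0,0), (-2 + w, 0), (-2 - w, 0)}`
(`x² + 4x + 2 = (x + 2 - w)(x + 2 + w)`). [cite: SilvermanAEC2009, III.2.3] -/
theorem two_torsion_cases (h2 : (2 : F) ≠ 0) (hw : w ^ 2 = 2) {P : V.toAffine.Point} (hP : P + P = 0)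
    (h0 : V.toAffine.Nonsingular 0 0) (hp : V.toAffine.Nonsingular (-2 + w) 0) (hm : V.toAffine.Nonsingular (-2 - w) 0) :
    P = 0 ∨ P = .some 0 0 h0 ∨ P = .some (-2 + w) 0 hp ∨ P = .some (-2 - w) 0 hm := by
  rcases eq_of_add_self_eq_zero h₁ h₂ h₃ h₄ h₆ h2 hP with h | ⟨x, h, rfl, hx⟩
  · exact Or.inl h
  · right
    have hx' : x * ((x + 2 - w) * (x + 2 + w)) = 0 := by
      rw [← hx]; linear_combination -x * hw
    rcases mul_eq_zero.mp hx' with hx0 | hx1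
    · exact Or.inl (pt_eq hx0 rfl)
    · rcases mul_eq_zero.mp hx1 with ha | hb
      · exact Or.inr (Or.inl (pt_eq (by linear_combination ha) rfl))
      · exact Or.inr (Or.inr (pt_eq (by linear_combination hb) rfl))

omit h₆ in
/-- **`2R = T₀`** for `R = (w, 2t)`, `w² = 2`, `t² = 2 + w`: the tangent at `R` has slope `λ` with `λt = 2 + 2w`,
`λ² = 4 + 2w`, so `x(2R) = λ² - 4 - 2w = 0` and `y(2R) = 0`. [cite: SilvermanAEC2009, III.2.3 (duplication formula)] -/
theorem R_add_R (h2 : (2 : F) ≠ 0) (hw : w ^ 2 = 2) (ht : t ^ 2 = 2 + w)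
    (hR : V.toAffine.Nonsingular w (2 * t)) (h0 : V.toAffine.Nonsingular 0 0) :
    (.some w (2 * t) hR : V.toAffine.Point) + .some w (2 * t) hR = .some 0 0 h0 := by
  have h4 : (4 : F) ≠ 0 := by rw [show (4 : F) = 2 * 2 by norm_num]; exact mul_ne_zero h2 h2
  have ht0 : t ≠ 0 := by
    intro h; rw [h] at ht
    have hw' : w = -2 := by linear_combination -ht
    rw [hw'] at hw; apply h2; linear_combination hw
  have hneg : V.toAffine.negY w (2 * t) = -(2 * t) := negY_eq h₁ h₃ _ _
  have hyne : 2 * t ≠ V.toAffine.negY w (2 * t) := by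
    rw [hneg]; intro h
    have : (2 : F) * (2 * t) = 0 := by linear_combination h
    exact mul_ne_zero h2 (mul_ne_zero h2 ht0) this
  rw [Affine.Point.add_self_of_Y_ne hyne]
  set ℓ := V.toAffine.slope w w (2 * t) (2 * t) with hℓdef
  have hℓ : ℓ = (3 * w ^ 2 + 2 * V.a₂ * w + V.a₄ - V.a₁ * (2 * t)) / (2 * t - V.toAffine.negY w (2 * t)) := by
    rw [hℓdef, Affine.slope_of_Y_ne rfl hyne]
  rw [hneg, h₁, h₂, h₄] at hℓ
  have hℓt : ℓ * t = 2 + 2 * w := by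
    have e : ℓ * (4 * t) = 8 + 8 * w := by
      rw [hℓ, show 2 * t - -(2 * t) = 4 * t by ring, div_mul_cancel₀ _ (mul_ne_zero h4 ht0)]
      linear_combination 3 * hw
    have e' : ℓ * t * 4 = (2 + 2 * w) * 4 := by linear_combination e
    exact mul_right_cancel₀ h4 e'
  have hℓ2 : ℓ ^ 2 = 4 + 2 * w := by
    have e : ℓ ^ 2 * t ^ 2 = (4 + 2 * w) * t ^ 2 := by
      calc ℓ ^ 2 * t ^ 2 = (ℓ * t) ^ 2 := by ring
        _ = (2 + 2 * w) ^ 2 := by rw [hℓt]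
        _ = (4 + 2 * w) * t ^ 2 := by rw [ht]; linear_combination 2 * hw
    exact mul_right_cancel₀ (pow_ne_zero 2 ht0) e
  have hX : V.toAffine.addX w w ℓ = 0 := by
    rw [addX_eq h₁ h₂]; linear_combination hℓ2
  have hY : V.toAffine.addY w w (2 * t) ℓ = 0 := by
    rw [addY_eq h₁ h₂ h₃]
    have : ℓ * (ℓ ^ 2 - 4 - w - w - w) + 2 * t = 0 := by
      have e : (ℓ * (ℓ ^ 2 - 4 - w - w - w) + 2 * t) * t = 0 := by
        calc (ℓ * (ℓ ^ 2 - 4 - w - w - w) + 2 * t) * t = ℓ * t * (ℓ ^ 2 - 4 - 3 * w) + 2 * t ^ 2 := by ring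
          _ = 0 := by rw [hℓt, hℓ2, ht]; linear_combination -2 * hw
      exact (mul_eq_zero.mp e).resolve_right ht0
    linear_combination -this
  exact pt_eq hX hY

omit h₄ h₆ in
/-- **`(w, 2t) + (-2 - w, 0) = (-w, 2t(1 - w))`** for `w² = 2`, `t² = 2 + w` (either sign of `t`): the chord has slope
`λ = t(w - 1)` (`(1 + w)(w - 1) = 1`), `λ² = 2 - w`. [cite: SilvermanAEC2009, III.2.3 (group law)] -/
theorem R_add_Tm (h2 : (2 : F) ≠ 0) (hw : w ^ 2 = 2) (ht : t ^ 2 = 2 + w)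
    (hR : V.toAffine.Nonsingular w (2 * t)) (hm : V.toAffine.Nonsingular (-2 - w) 0)
    (h' : V.toAffine.Nonsingular (-w) (2 * t * (1 - w))) :
    (.some w (2 * t) hR : V.toAffine.Point) + .some (-2 - w) 0 hm = .some (-w) (2 * t * (1 - w)) h' := by
  have hx : w ≠ -2 - w := by
    intro h
    have hw1 : w = -1 := by
      have : (2 : F) * w = 2 * (-1) := by linear_combination h
      exact mul_left_cancel₀ h2 this
    rw [hw1] at hw; apply h2; linear_combination -2 * hw
  rw [Affine.Point.add_of_X_ne hx]
  set ℓ := V.toAffine.slope w (-2 - w) (2 * t) 0 with hℓdef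
  have hℓ : ℓ = (2 * t - 0) / (w - (-2 - w)) := by rw [hℓdef, Affine.slope_of_X_ne hx]
  have hℓ1 : ℓ * (2 + 2 * w) = 2 * t := by
    rw [hℓ, show w - (-2 - w) = 2 + 2 * w by ring, div_mul_cancel₀ _ (by
      intro h; apply hx; linear_combination h)]
    ring
  have hℓ' : ℓ = t * (w - 1) := by
    have e : 2 * ℓ = 2 * (t * (w - 1)) := by linear_combination (w - 1) * hℓ1 - 2 * ℓ * hw
    exact mul_left_cancel₀ h2 e
  have hℓ2 : ℓ ^ 2 = 2 - w := by
    rw [hℓ', mul_pow, ht]; linear_combination w * hw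
  have hX : V.toAffine.addX w (-2 - w) ℓ = -w := by
    rw [addX_eq h₁ h₂, hℓ2]; ring
  have hY : V.toAffine.addY w (-2 - w) (2 * t) ℓ = 2 * t * (1 - w) := by
    rw [addY_eq h₁ h₂ h₃, hℓ2, hℓ']; linear_combination 2 * t * hw
  exact pt_eq hX hY

omit h₄ h₆ in
/-- **`T₊ + T₋ = T₀`**: `(-2 + w, 0) + (-2 - w, 0) = (0, 0)` (horizontal chord). [cite: SilvermanAEC2009, III.2.3] -/
theorem Tp_add_Tm (h2 : (2 : F) ≠ 0) (hw : w ^ 2 = 2)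
    (hp : V.toAffine.Nonsingular (-2 + w) 0) (hm : V.toAffine.Nonsingular (-2 - w) 0)
    (h0 : V.toAffine.Nonsingular 0 0) :
    (.some (-2 + w) 0 hp : V.toAffine.Point) + .some (-2 - w) 0 hm = .some 0 0 h0 := by
  have hw0 : w ≠ 0 := by rintro rfl; apply h2; linear_combination -hw
  have hx : -2 + w ≠ -2 - w := by
    intro h
    have : (2 : F) * w = 0 := by linear_combination h
    exact mul_ne_zero h2 hw0 this
  rw [Affine.Point.add_of_X_ne hx]
  set ℓ := V.toAffine.slope (-2 + w) (-2 - w) 0 0 with hℓdef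
  have hℓ : ℓ = 0 := by rw [hℓdef, Affine.slope_of_X_ne hx]; ring
  have hX : V.toAffine.addX (-2 + w) (-2 - w) ℓ = 0 := by
    rw [addX_eq h₁ h₂, hℓ]; ring
  have hY : V.toAffine.addY (-2 + w) (-2 - w) 0 ℓ = 0 := by
    rw [addY_eq h₁ h₂ h₃, hℓ]; ring
  exact pt_eq hX hY

end GroupLaw

/-! ### §2 The abstract `8`-torsion lemma -/

section Abstract

variable {G : Type*} [AddCommGroup G]

/-- `n • x = 0 ↔ ord(x) ∣ n`, with the order substituted. [cite: SilvermanAEC2009, III.§6] -/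
theorem zsmul_eq_zero_iff_of_addOrderOf {x : G} {m : ℕ} (hx : addOrderOf x = m) (n : ℤ) :
    n • x = 0 ↔ (m : ℤ) ∣ n := by
  rw [← addOrderOf_dvd_iff_zsmul_eq_zero, hx]

/-- Orders `2, 4, 8` along a chain `2S = R`, `2R = T`, `2T = 0`, `T ≠ 0`. [cite: SilvermanAEC2009, III.§6] -/
theorem addOrderOf_chain {S R T : G} (h2S : (2 : ℤ) • S = R) (h2R : (2 : ℤ) • R = T)
    (h2T : (2 : ℤ) • T = 0) (hT : T ≠ 0) : addOrderOf T = 2 ∧ addOrderOf R = 4 ∧ addOrderOf S = 8 := by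
  have e : ∀ (k : ℕ) (P : G), k • P = (k : ℤ) • P := fun k P ↦ (natCast_zsmul P k).symm
  have h4R : (4 : ℤ) • R = 0 := by rw [show (4 : ℤ) = 2 * 2 by norm_num, mul_zsmul, h2R, h2T]
  have h4S : (4 : ℤ) • S = T := by rw [show (4 : ℤ) = 2 * 2 by norm_num, mul_zsmul, h2S, h2R]
  have h8S : (8 : ℤ) • S = 0 := by rw [show (8 : ℤ) = 2 * 4 by norm_num, mul_zsmul, h4S, h2T]
  have hT' : addOrderOf T = 2 := by
    have := addOrderOf_eq_prime_pow (p := 2) (n := 0) (x := T) (by simpa using hT)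
      (by rw [e]; simpa using h2T)
    simpa using this
  have hR' : addOrderOf R = 4 := by
    have := addOrderOf_eq_prime_pow (p := 2) (n := 1) (x := R) (by rw [e]; simpa [h2R] using hT)
      (by rw [e]; simpa using h4R)
    simpa using this
  have hS' : addOrderOf S = 8 := by
    have := addOrderOf_eq_prime_pow (p := 2) (n := 2) (x := S) (by rw [e]; simpa [h4S] using hT)
      (by rw [e]; simpa using h8S)
    simpa using this
  exact ⟨hT', hR', hS'⟩

/-- **The abstract `8`-torsion argument.**  In an abelian group with commuting endomorphisms `σ`, `ψ` with
`ψ² = [-2]`, let `2S = R`, `2R = T₀ ≠ 0`, `2T₀ = 0`, `T₋ ≠ 0`, `2T₋ = 0`, `ψR = T₋`, `ψT± = T₀`, `σT₀ = T₀`,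
`σT± = T∓`, `T₊ + T₋ = T₀`, the `2`-torsion be `{O, T₀, T₊, T₋}`, and `σR = εR + T₋` with `ε = ±1`.  If
`σ²S - aσS + qS = 0` with `q ≡ 3 (mod 8)` then `a ≡ 2ε (mod 8)`.  Proof: `4 •` the relation gives `a` even, `a = 2a'`;
`X := σS - εS - ψS` is `2`-torsion, whence `X + ψX + σX = 0` and `σ²S = -S + T₋`; the relation becomes
`(q - 1 - 2a'ε)S + (1 - a')T₋ = 0`, so (`2 •`) `a'` is odd and then `8 ∣ q - 1 - 2a'ε`.  This is the mechanism of
Rajwade's determination of the Frobenius of `y² = x³ + 4x² + 2x` modulo `4√-2`. [cite: Rajwade1968, Thm. 1] -/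
theorem trace_mod_eight (σ ψ : G →+ G)
    (hcomm : ∀ P, ψ (σ P) = σ (ψ P)) (hψψ : ∀ P, ψ (ψ P) = (-2 : ℤ) • P)
    {S R T₀ Tp Tm : G} (h2S : (2 : ℤ) • S = R) (h2R : (2 : ℤ) • R = T₀) (h2T₀ : (2 : ℤ) • T₀ = 0)
    (hT₀ : T₀ ≠ 0) (hTm : Tm ≠ 0) (h2Tm : (2 : ℤ) • Tm = 0)
    (hψR : ψ R = Tm) (hψTp : ψ Tp = T₀) (hψTm : ψ Tm = T₀)
    (hσT₀ : σ T₀ = T₀) (hσTp : σ Tp = Tm) (hσTm : σ Tm = Tp) (hTpm : Tp + Tm = T₀)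
    {ε : ℤ} (hε : ε = 1 ∨ ε = -1) (hσR : σ R = ε • R + Tm)
    (htors : ∀ X : G, (2 : ℤ) • X = 0 → X = 0 ∨ X = T₀ ∨ X = Tp ∨ X = Tm)
    {a q : ℤ} (hq : q % 8 = 3) (hManin : σ (σ S) - a • σ S + q • S = 0) :
    a % 8 = (2 * ε) % 8 := by
  obtain ⟨hoT₀, hoR, hoS⟩ := addOrderOf_chain h2S h2R h2T₀ hT₀
  have hoTm : addOrderOf Tm = 2 := by
    have e : ∀ (k : ℕ) (P : G), k • P = (k : ℤ) • P := fun k P ↦ (natCast_zsmul P k).symm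
    have := addOrderOf_eq_prime_pow (p := 2) (n := 0) (x := Tm) (by simpa using hTm)
      (by rw [e]; simpa using h2Tm)
    simpa using this
  have zS := zsmul_eq_zero_iff_of_addOrderOf hoS
  have zR := zsmul_eq_zero_iff_of_addOrderOf hoR
  have zT₀ := zsmul_eq_zero_iff_of_addOrderOf hoT₀
  have zTm := zsmul_eq_zero_iff_of_addOrderOf hoTm
  push_cast at zS zR zT₀ zTm
  have h4S : (4 : ℤ) • S = T₀ := by rw [show (4 : ℤ) = 2 * 2 by norm_num, mul_zsmul, h2S, h2R]
  -- `ψ T₀ = 0`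
  have hψT₀ : ψ T₀ = 0 := by
    have h2 : (2 : ℤ) • ψ T₀ = 0 := by rw [← map_zsmul, h2T₀, map_zero]
    have hψψ0 : ψ (ψ T₀) = 0 := by rw [hψψ, show (-2 : ℤ) = -1 * 2 by norm_num, mul_zsmul, h2T₀, smul_zero]
    rcases htors _ h2 with h | h | h | h
    · exact h
    · rw [h] at hψψ0; exact hψψ0
    · rw [h, hψTp] at hψψ0; exact absurd hψψ0 hT₀
    · rw [h, hψTm] at hψψ0; exact absurd hψψ0 hT₀
  -- `a` is even: apply `4 •` to the relation
  have haeven : a % 2 = 0 := by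
    have e1 : (4 : ℤ) • σ (σ S) = T₀ := by rw [← map_zsmul, ← map_zsmul, h4S, hσT₀, hσT₀]
    have e2 : (4 : ℤ) • (a • σ S) = a • T₀ := by rw [smul_comm, ← map_zsmul, h4S, hσT₀]
    have e3 : (4 : ℤ) • (q • S) = q • T₀ := by rw [smul_comm, h4S]
    have h := congrArg (fun P ↦ (4 : ℤ) • P) hManin
    simp only [zsmul_sub, zsmul_add, smul_zero, e1, e2, e3] at h
    have h' : (1 - a + q) • T₀ = 0 := by rw [add_smul, sub_smul, one_smul]; exact h
    rw [zT₀] at h'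
    omega
  obtain ⟨a', rfl⟩ : ∃ a', a = 2 * a' := ⟨a / 2, by omega⟩
  -- the defect `X`
  set X := σ S - ε • S - ψ S with hX
  have hσS : σ S = ε • S + ψ S + X := by rw [hX]; abel
  have h2X : (2 : ℤ) • X = 0 := by
    rw [hX, zsmul_sub, zsmul_sub, ← map_zsmul, ← map_zsmul, smul_comm, h2S, hσR, hψR]; abel
  have hnegX : -X = X := by
    rw [neg_eq_iff_add_eq_zero, ← two_zsmul]; exact h2X
  have hεX : ε • X = X := by
    rcases hε with rfl | rfl
    · exact one_zsmul X
    · rw [neg_one_zsmul]; exact hnegX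
  have hXsum : X + ψ X + σ X = 0 := by
    rcases htors X h2X with h | h | h | h <;> rw [h]
    · simp
    · rw [hψT₀, hσT₀, add_zero, ← two_zsmul, h2T₀]
    · rw [hψTp, hσTp, add_assoc, add_comm T₀, ← add_assoc, hTpm, ← two_zsmul, h2T₀]
    · rw [hψTm, hσTm, add_assoc, add_comm T₀, ← add_assoc, add_comm Tm, hTpm, ← two_zsmul, h2T₀]
  have hnegTm : -Tm = Tm := by
    rw [neg_eq_iff_add_eq_zero, ← two_zsmul]; exact h2Tm
  have h2εψ : (2 * ε) • ψ S = Tm := by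
    rw [mul_comm, mul_zsmul, ← map_zsmul, h2S, hψR]
    rcases hε with rfl | rfl
    · exact one_zsmul _
    · rw [neg_one_zsmul]; exact hnegTm
  have hεε : ε * ε = 1 := by rcases hε with rfl | rfl <;> norm_num
  -- `σ (σ S) = -S + T₋`
  have hσσ : σ (σ S) = -S + Tm := by
    have e1 : σ (σ S) = ε • σ S + ψ (σ S) + σ X := by
      conv_lhs => rw [hσS]
      rw [map_add, map_add, map_zsmul, hcomm]
    rw [e1, hσS, map_add, map_add, map_zsmul, hψψ, zsmul_add, zsmul_add, ← mul_zsmul, hεε, one_zsmul, hεX]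
    have : ε • ψ S + ε • ψ S = Tm := by rw [← two_zsmul, ← mul_zsmul, h2εψ]
    calc S + ε • ψ S + X + (ε • ψ S + (-2 : ℤ) • S + ψ X) + σ X
        = S + (-2 : ℤ) • S + (ε • ψ S + ε • ψ S) + (X + ψ X + σ X) := by abel
      _ = -S + Tm := by rw [this, hXsum, add_zero]; module
  -- plug into the relation
  have eψ : (2 * a') • ψ S = a' • Tm := by rw [mul_comm, mul_zsmul, ← map_zsmul, h2S, hψR]
  have eX : (2 * a') • X = 0 := by rw [mul_comm, mul_zsmul, h2X, smul_zero]
  rw [hσσ, hσS, zsmul_add, zsmul_add, eψ, eX, add_zero, ← mul_zsmul] at hManin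
  have key : (q - 1 - 2 * a' * ε) • S + (1 - a') • Tm = 0 := by
    rw [show (q - 1 - 2 * a' * ε) • S + (1 - a') • Tm = -S + Tm - ((2 * a' * ε) • S + a' • Tm) + q • S by
      module]
    exact hManin
  -- `2 •`: `a'` is odd
  have hodd : (4 : ℤ) ∣ (q - 1 - 2 * a' * ε) := by
    have h := congrArg (fun P ↦ (2 : ℤ) • P) key
    simp only [zsmul_add, smul_zero, ← mul_zsmul] at h
    rw [mul_comm (2 : ℤ) (q - 1 - 2 * a' * ε), mul_zsmul, h2S, mul_comm (2 : ℤ) (1 - a'), mul_zsmul, h2Tm,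
      smul_zero, add_zero, zR] at h
    exact h
  have hTm0 : (1 - a') • Tm = 0 := by
    rw [zTm]; rcases hε with rfl | rfl <;> omega
  rw [hTm0, add_zero, zS] at key
  rcases hε with rfl | rfl <;> omega

end Abstract

/-! ### §3 Arithmetic of `\bar 𝔽_p` for `p ≡ 3 (mod 8)` and the explicit points of `B₁(\bar 𝔽_p)` -/

section BarFp

variable {p : ℕ} [Fact p.Prime]

/-- `2^{(p-1)/2} = -1` in `𝔽_p` for `p ≡ 3 (mod 8)` (Euler's criterion and the second supplement).
[cite: IrelandRosen1990, Ch. 5 §1 Prop. 5.1.3] -/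
theorem two_pow_div_two (hp8 : p % 8 = 3) : (2 : ZMod p) ^ (p / 2) = -1 := by
  have hp2 : p ≠ 2 := by rintro rfl; norm_num at hp8
  have h2 : (2 : ZMod p) ≠ 0 := DeuringSqrtTwo.two_ne_zero_zmod hp2
  rcases ZMod.pow_div_two_eq_neg_one_or_one p h2 with h | h
  · exfalso
    have hsq : IsSquare (2 : ZMod p) := (ZMod.euler_criterion p h2).mpr h
    rw [ZMod.exists_sq_eq_two_iff hp2] at hsq
    omega
  · exact h

/-- `2^{(p-1)/2} = -1` in `\bar 𝔽_p` for `p ≡ 3 (mod 8)`. [cite: IrelandRosen1990, Ch. 5 §1 Prop. 5.1.3] -/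
theorem two_pow_div_two_bar (hp8 : p % 8 = 3) : (2 : AlgebraicClosure (ZMod p)) ^ (p / 2) = -1 := by
  have h := congrArg (algebraMap (ZMod p) (AlgebraicClosure (ZMod p))) (two_pow_div_two hp8)
  rwa [map_pow, map_ofNat, map_neg, map_one] at h

/-- `x^p = (x²)^{(p-1)/2} x` for odd `p`. [cite: IrelandRosen1990, Ch. 5 §1] -/
theorem pow_p_eq (hp2 : p ≠ 2) (x : AlgebraicClosure (ZMod p)) : x ^ p = (x ^ 2) ^ (p / 2) * x := by
  have hodd : p % 2 = 1 := (Fact.out : p.Prime).eq_two_or_odd.resolve_left hp2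
  rw [show x ^ p = x ^ ((p / 2) * 2 + 1) from by congr 1; omega, pow_succ, pow_mul']

/-- `w^p = -w` for `w² = 2` in `\bar 𝔽_p`, `p ≡ 3 (mod 8)` (`2` is a non-residue).
[cite: IrelandRosen1990, Ch. 5 §1 Prop. 5.1.3] -/
theorem w_pow_p (hp8 : p % 8 = 3) {w : AlgebraicClosure (ZMod p)} (hw : w ^ 2 = 2) : w ^ p = -w := by
  have hp2 : p ≠ 2 := by rintro rfl; norm_num at hp8
  rw [pow_p_eq hp2, hw, two_pow_div_two_bar hp8]; ring

/-- `t^p = (2 + w)^{(p-1)/2} t` for `t² = 2 + w`. [cite: IrelandRosen1990, Ch. 5 §1] -/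
theorem t_pow_p (hp2 : p ≠ 2) {w t : AlgebraicClosure (ZMod p)} (ht : t ^ 2 = 2 + w) :
    t ^ p = (2 + w) ^ (p / 2) * t := by
  rw [pow_p_eq hp2, ht]

/-- **The octic evaluation.** For `p ≡ 3 (mod 8)`, `w² = 2`, `δ² = -2` in `\bar 𝔽_p`:
`(2 + w)^{(p-1)/2} = 1 - w` if `p ≡ 11 (mod 16)` and `= w - 1` if `p ≡ 3 (mod 16)`.  Proof: `η = (w + δ)/2` has
`η² = wη - 1`, `η⁴ = -1`, `η⁻¹ = w - η`, `(η + 1)² = (2 + w)η`; `(η + 1)^p = η³ + 1`, so `(η + 1)^{p-1} = η² - η + 1`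
and `(2 + w)^{(p-1)/2} = (η² - η + 1)/η^{(p-1)/2}` with `η^{(p-1)/2} = η` resp. `-η`.
[cite: IrelandRosen1990, Ch. 5 §1 (the argument for `(2/p)` via `ζ₈`, one level up)] -/
theorem two_add_w_pow (hp8 : p % 8 = 3) {w δ : AlgebraicClosure (ZMod p)} (hw : w ^ 2 = 2) (hδ : δ ^ 2 = -2) :
    (2 + w) ^ (p / 2) = if p % 16 = 11 then 1 - w else w - 1 := by
  have hp2 : p ≠ 2 := by rintro rfl; norm_num at hp8
  have h2 : (2 : AlgebraicClosure (ZMod p)) ≠ 0 := DeuringSqrtTwo.two_ne_zero_bar hp2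
  have h4 : (4 : AlgebraicClosure (ZMod p)) ≠ 0 := by
    rw [show (4 : AlgebraicClosure (ZMod p)) = 2 * 2 by norm_num]; exact mul_ne_zero h2 h2
  set η : AlgebraicClosure (ZMod p) := (w + δ) / 2 with hηdef
  have h2η : 2 * η = w + δ := by rw [hηdef]; field_simp
  have hη2 : η ^ 2 = w * η - 1 := by
    have e : 4 * η ^ 2 = 4 * (w * η - 1) := by linear_combination (2 * η - w + δ) * h2η - hw + hδ
    exact mul_left_cancel₀ h4 e
  have hη0 : η ≠ 0 := by
    intro h; rw [h] at hη2; apply one_ne_zero (α := AlgebraicClosure (ZMod p)); linear_combination hη2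
  have hη4 : η ^ 4 = -1 := by
    calc η ^ 4 = (η ^ 2) ^ 2 := by ring
      _ = -1 := by rw [hη2]; linear_combination η ^ 2 * hw + 2 * hη2
  have hη8 : η ^ 8 = 1 := by
    calc η ^ 8 = (η ^ 4) ^ 2 := by ring
      _ = 1 := by rw [hη4]; ring
  have hinv : η⁻¹ = w - η := by
    have : η * (w - η) = 1 := by linear_combination -hη2
    rw [inv_eq_of_mul_eq_one_right this]
  have hη1 : η + 1 ≠ 0 := by
    intro h
    have e : η = -1 := by linear_combination h
    rw [e] at hη4
    apply h2; linear_combination hη4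
  have hsq : (η + 1) ^ 2 = (2 + w) * η := by linear_combination hη2
  have hfrob : (η + 1) ^ p = η ^ 3 + 1 := by
    rw [add_pow_char η 1 p, one_pow,
      show η ^ p = η ^ (8 * (p / 8) + 3) from by congr 1; omega, pow_add, pow_mul, hη8, one_pow, one_mul]
  set m := p / 2 with hm
  have hpm : p = 2 * m + 1 := by
    have := (Fact.out : p.Prime).eq_two_or_odd.resolve_left hp2; omega
  have e2 : (η + 1) ^ (2 * m) = η ^ 2 - η + 1 := by
    have e : (η + 1) ^ (2 * m) * (η + 1) = (η ^ 2 - η + 1) * (η + 1) := by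
      rw [← pow_succ, ← hpm, hfrob]; ring
    exact mul_right_cancel₀ hη1 e
  have e1 : (2 + w) = (η + 1) ^ 2 * η⁻¹ := by rw [hsq, mul_assoc, mul_inv_cancel₀ hη0, mul_one]
  rw [e1, mul_pow, ← pow_mul, e2, inv_pow]
  by_cases h16 : p % 16 = 11
  · rw [if_pos h16]
    have hm8 : m = 8 * (m / 8) + 5 := by omega
    have : η ^ m = -η := by
      rw [hm8, pow_add, pow_mul, hη8, one_pow, one_mul,
        show η ^ 5 = η ^ 4 * η by ring, hη4]; ring
    rw [this, inv_neg, hinv]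
    linear_combination (η - 1) * hη2
  · rw [if_neg h16]
    have hm8 : m = 8 * (m / 8) + 1 := by omega
    have : η ^ m = η := by rw [hm8, pow_add, pow_mul, hη8, one_pow, one_mul, pow_one]
    rw [this, hinv]
    linear_combination (1 - η) * hη2

/-- The base change of `E : y² = x³ + 4x² + 2x` (`DeuringSqrtTwo.curve p`) to `\bar 𝔽_p` has
`(a₁, a₂, a₃, a₄, a₆) = (0, 4, 0, 2, 0)`. [cite: SilvermanAdvancedTopics1994, II Prop. 2.3.1] -/
theorem a_baseChange :
    ((DeuringSqrtTwo.curve p).baseChange (AlgebraicClosure (ZMod p))).a₁ = 0 ∧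
    ((DeuringSqrtTwo.curve p).baseChange (AlgebraicClosure (ZMod p))).a₂ = 4 ∧
    ((DeuringSqrtTwo.curve p).baseChange (AlgebraicClosure (ZMod p))).a₃ = 0 ∧
    ((DeuringSqrtTwo.curve p).baseChange (AlgebraicClosure (ZMod p))).a₄ = 2 ∧
    ((DeuringSqrtTwo.curve p).baseChange (AlgebraicClosure (ZMod p))).a₆ = 0 := by
  simp only [WeierstrassCurve.baseChange, WeierstrassCurve.map_a₁, WeierstrassCurve.map_a₂,
    WeierstrassCurve.map_a₃, WeierstrassCurve.map_a₄, WeierstrassCurve.map_a₆, DeuringSqrtTwo.curve,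
    map_ofNat, map_zero]
  exact ⟨trivial, trivial, trivial, trivial, trivial⟩

/-- **Frobenius on an explicit point**: an `𝔽_p`-algebra map acting as `x ↦ x^p` on coordinates sends `(x, y)` to
`(x^p, y^p)`. [cite: SilvermanAEC2009, V.§2 (the `q`-power Frobenius)] -/
theorem map_some_of_pow {f : AlgebraicClosure (ZMod p) →ₐ[ZMod p] AlgebraicClosure (ZMod p)}
    (hf : ∀ x, f x = x ^ p) {x y x' y' : AlgebraicClosure (ZMod p)}
    (h : ((DeuringSqrtTwo.curve p).baseChange (AlgebraicClosure (ZMod p))).toAffine.Nonsingular x y)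
    (h' : ((DeuringSqrtTwo.curve p).baseChange (AlgebraicClosure (ZMod p))).toAffine.Nonsingular x' y')
    (hx : x ^ p = x') (hy : y ^ p = y') :
    Affine.Point.map f (Affine.Point.some x y h) = Affine.Point.some x' y' h' := by
  rw [Affine.Point.map_some]
  exact pt_eq (by rw [← hx]; exact hf x) (by rw [← hy]; exact hf y)

variable (hp2 : p ≠ 2)

/-- **`ψ R = T₋`**: `[√-2](w, 2t) = (-2 - w, 0)` (`x ↦ -(x² + 4x + 2)/(2x)` at `x = w`, `w² = 2`; the
`y`-coordinate carries the factor `x² - 2 = 0`). [cite: SilvermanAdvancedTopics1994, II Prop. 2.3.1] -/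
theorem sqrtNegTwo_R (s : ZMod p) (hs : s ^ 2 = -2) {w t : AlgebraicClosure (ZMod p)} (hw : w ^ 2 = 2)
    (hR : ((DeuringSqrtTwo.curve p).baseChange (AlgebraicClosure (ZMod p))).toAffine.Nonsingular w (2 * t))
    (hm : ((DeuringSqrtTwo.curve p).baseChange (AlgebraicClosure (ZMod p))).toAffine.Nonsingular (-2 - w) 0) :
    DeuringSqrtTwo.sqrtNegTwo hp2 s hs (Affine.Point.some w (2 * t) hR) = Affine.Point.some (-2 - w) 0 hm := by
  have h2 : (2 : AlgebraicClosure (ZMod p)) ≠ 0 := DeuringSqrtTwo.two_ne_zero_bar hp2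
  have hw0 : w ≠ 0 := by rintro rfl; apply h2; linear_combination -hw
  obtain ⟨h', e⟩ := DeuringSqrtTwo.sqrtNegTwo_some hp2 s hs hR hw0
  rw [e]
  have hx : -((w ^ 2 + 4 * w + 2) / w) / 2 = -2 - w := by
    rw [hw]; field_simp; linear_combination 2 * hw
  have hy : algebraMap (ZMod p) (AlgebraicClosure (ZMod p)) s / 4 * (2 * t * (w ^ 2 - 2) / w ^ 2) = 0 := by
    rw [hw]; ring
  exact pt_eq hx hy

/-- **`ψ T± = T₀`**: `[√-2](x, 0) = (0, 0)` for a root `x` of `x² + 4x + 2`.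
[cite: SilvermanAdvancedTopics1994, II Prop. 2.3.1] -/
theorem sqrtNegTwo_T (s : ZMod p) (hs : s ^ 2 = -2) {x : AlgebraicClosure (ZMod p)} (hx0 : x ≠ 0)
    (hx : x ^ 2 + 4 * x + 2 = 0)
    (hT : ((DeuringSqrtTwo.curve p).baseChange (AlgebraicClosure (ZMod p))).toAffine.Nonsingular x 0)
    (h0 : ((DeuringSqrtTwo.curve p).baseChange (AlgebraicClosure (ZMod p))).toAffine.Nonsingular 0 0) :
    DeuringSqrtTwo.sqrtNegTwo hp2 s hs (Affine.Point.some x 0 hT) = Affine.Point.some 0 0 h0 := by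
  obtain ⟨h', e⟩ := DeuringSqrtTwo.sqrtNegTwo_some hp2 s hs hT hx0
  rw [e]
  exact pt_eq (by rw [hx]; simp) (by simp)

end BarFp

end EightTorsion

end SqrtTwoTwist

end Literature.NumberTheory.EllipticCurves
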